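import Summits.QuantumFields.YangMills.Theorems.BalabanUVNodesN12GuardedChartDerivDeviation
import Summits.QuantumFields.YangMills.Theorems.BalabanUVNodesN12GuardedLinAvgRightInverse
import Literature.MathematicalPhysics.QuantumFieldTheory.Balaban1983to89.Node00.MultiScaleFibreChartMultiplier
import Literature.MathematicalPhysics.QuantumFieldTheory.Balaban1983to89.Node00.MultiScaleFibreChartLocality
import Summits.QuantumFields.YangMills.Theorems.BalabanUVNodesN21AveragedDatumRegularity
import Summits.QuantumFields.YangMills.Theorems.UnitScaleTiltSmoothLiftPerturbation

/-!
# DAG node N12 [B15] — THE LETTER (δ₂) OF THE ASSEMBLED ENDPOINT's PACKAGE (N) IN THE JUNCTION's CURRENCY, PER HEIGHT: `‖DΨ(0)w − DΦ♭(0)w‖ ≤ (C·‖↑U₀ − 1‖)·p(w)` for the chart of record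
# `Ψ := msChart F N K k 𝐁 W U₀` against the FLAT chart `Φ♭ := msChart F N K k 𝐁 (M˙1) 1`, ONE `C, ρ` per height — dag-n10-w1's module D + dag-n12-w3's flat identification, re-keyed by name

[Balaban1989LargeFieldII] = «[LF-II]», p. 357 («we write U₀ = exp(iA₀) and expand in A₀ up to first order»), (1.12) p. 359; [Balaban1985Variational] = «[15]», Sect. C (44)–(48) p. 285, (82)–(83) p. 290;
[Balaban1985Averaging], Prop. 3 (121)–(125) p. 36; [Balaban1988Convergent] = «[III]», (2.10)–(2.12) p. 256.

Cell `pub-ymgap`, HUMAN RULING D-0062 ∕ D-0149, width seat `pub-ymgap-dag-n12-w4` generation 3 (WIDTH SEAT 4 of 4 on N12; lane U2c; INBOX CLAIM-5 ∕ INTENT-5 of 2026-08-28).  `--kind proof --supports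
stmt-QuantumFields-20542 --as helper` (K1⁷; count-neutral).  NEW leaf; CONSUMED BY NAME, nothing modified: dag-n10-w1's module D `…N12GuardedChartDerivDeviation.exists_norm_fderiv_msChart_sub_suProj_iterLin_le`
(p601xxx lineage: `DΨ_{U₀}(0)` vs `π∘Q^{(j)}` at a guarded near-flat `U₀`, self-datum `M˙U₀`), dag-n12-w3∕n10-w1's `…N12FlatChartDerivIterLin.fderiv_msChart_one_apply_eq_iterLin` (the FLAT chart derivative IS
`π∘Q^{(j)}`), this seat's `Node00.MultiScaleFibreChartMultiplier.msChart_eq_msChart_avgFamily_of_agreeOn` (datum congruence: J-C's datum vs the self-datum) and dag-n12-w2's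
`B16Ineq19NearFlatSliceNorms.opNorm_coe_le_norm_lieSU`.

WHY.  The lane owner's assembled endpoint `B15Prop1EndpointNearFlatLetters` (p610003 ∕ p612688) binds per slice vector `X` the letter (δ₂) `hδ₂ : q(DΨ(0)(X_f′X) − Lf(X_f′X)) ≤ δ₂·p(X_f′X)` with `Ψ` the
chart of record at the background `U₀` and datum `W = M˙(Q_k^{s*}Ṽ)`, `Lf` the knit's flat linearised constraint.  dag-n10-w1's module D delivered the analytic content in sup-norm ∃-currency at the
SELF-datum `M˙(U₀)`; THIS MODULE re-keys it to the junction's shape: `Lf := DΦ♭(0)` the FLAT chart of record (the `Lf` of this seat's `hm` producer p611770 and of dag-n12-w3's `hnd` letters), `q := ‖·‖` on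
the constraint space (as in this seat's (μ) producers p613093 ∕ the uniform edition), ANY seminorm `p` with `Σ_b‖↑w_b‖²_op ≤ p(w)²`, the datum moved to `W` by the fibre condition — with `δ₂ := C·‖↑U₀ − 1‖`,
ONE `C, ρ` per height.

CONTENTS (namespace `Summit.QuantumFields.YangMills.BalabanUVNodes.N12NearFlatDelta2Letter`; theorems only — no `def`, no `instance`, no `sorry`).
* §1 `opNormField_le_seminorm` (`‖↑w‖_sup-op ≤ p(w)` from `hp`), `norm_sub_le_of_apply` (sup-norm bookkeeping).
* §3 ★★ `exists_rightInverse_fun_of_flat_of_delta2` (flat linear right inverse + pointwise (δ₂) ⟹ actual right inverse as a function, `p(Rv) ≤ ρ♭∕(1 − δ₂ρ♭)·‖v‖`), ★★★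
  `exists_rightInverse_fun_msChart_of_flat` (at the record: `hsurj` and the `R`-letter of `hlam`∕(μ) from ONE displayed object — the flat linear right inverse on `ConstrSet 𝐁 k`, way (ii)).
* §2 ★★★ `exists_delta2_letter` — ONE `C ≥ 0`, `ρ > 0` per height: for every guarded `U₀` (`Ū^i(U₀)` `t₀`-small below `k`, `stokesConst·t₀ < δ_N`) with `‖↑U₀ − 1‖ < ρ`, every `𝐁`, every datum `W`
  with `M˙(U₀) = W` on `𝐁`, and every direction `w`: `‖DΨ(0)w − DΦ♭(0)w‖ ≤ C·‖↑U₀ − 1‖·p(w)`; ★★ `exists_delta2_letter_Bj` (the record's `𝐁_k(Z)`).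

HONEST FRAMING ∕ LOCATED: composition by name; `C, ρ` are dag-n10-w1's per-height EXISTENCE constants («ρ′ EXISTS by smoothness constants; print's O(L²α₀) NOT claimed»), so (δ₂) here is
`O(‖↑U₀ − 1‖)` with a per-height constant, NOT print's volume-uniform one; the guard hypotheses are displayed as in module D; nothing of Bałaban's asserted; N12 NOT discharged; K1⁷ NOT closed;
counts unmoved (5∕27); one finite 𝕋⁴ programme at fixed ε — R4 closes the conditional finite-𝕋⁴ rung `BalabanLadder.UV` only; NOT continuum ∕ ℝ⁴ ∕ OS ∕ mass gap ∕ Clay.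
-/

noncomputable section

open scoped BigOperators Matrix.Norms.L2Operator Topology
open Filter Finset

namespace Summit.QuantumFields.YangMills.BalabanUVNodes.N12NearFlatDelta2Letter

open Literature.MathematicalPhysics.QuantumFieldTheory.Balaban1983to89
open T4Continuum (T4Family)
open BlockAveraging (blockAvg)
open ExpMeanLog (expMeanLogSU deltaSU)
open BlockAveragingEMLLinearised (linAvg)
open T4AdjointCovarianceUnitary (lieSU)
open B15DeterminingSets
open B14.Eq213DetSet (Bj)
open Node00
open Summit.QuantumFields.YangMills.Theorems.BlockAvgCorrector (stokesConst)
open Summit.QuantumFields.YangMills.BalabanUVNodes.N12GuardedChartDerivDeviation (exists_norm_fderiv_msChart_sub_suProj_iterLin_le)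
open Summit.QuantumFields.YangMills.BalabanUVNodes.N12FlatChartDerivIterLin (fderiv_msChart_one_apply_eq_iterLin)
open Summit.QuantumFields.YangMills.BalabanUVNodes.N12GuardedLinAvgRightInverse (exists_rightInverse_of_approx)
open B16Ineq19NearFlatSliceNorms (opNorm_coe_le_norm_lieSU)

variable {F : T4Family} {N : ℕ} [NeZero N] {K k : ℕ}

/-! ## §1  Norm bookkeeping -/

omit [NeZero N] in
/-- The sup over bonds of the operator norms of a bond field is dominated by the junction's seminorm: `Σ_b‖↑w_b‖²_op ≤ p(w)²` gives `‖↑w‖ ≤ p(w)`.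
[cite: Balaban1985Averaging, (17)–(19) p.21 (bookkeeping)] -/
theorem opNormField_le_seminorm (p : Seminorm ℝ (PBond (F.P K) 0 → lieSU (Fin N)))
    (hp : ∀ Y : PBond (F.P K) 0 → lieSU (Fin N), ∑ b, ‖(Y b : Matrix (Fin N) (Fin N) ℂ)‖ ^ 2 ≤ p Y ^ 2) (w : PBond (F.P K) 0 → lieSU (Fin N)) :
    ‖(fun b => (w b : Matrix (Fin N) (Fin N) ℂ))‖ ≤ p w := by
  have hp0 : 0 ≤ p w := apply_nonneg p w
  refine (pi_norm_le_iff_of_nonneg hp0).2 fun b => ?_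
  have hb : ‖(w b : Matrix (Fin N) (Fin N) ℂ)‖ ^ 2 ≤ p w ^ 2 :=
    (Finset.single_le_sum (fun b _ => sq_nonneg ‖(w b : Matrix (Fin N) (Fin N) ℂ)‖) (Finset.mem_univ b)).trans (hp w)
  calc ‖(w b : Matrix (Fin N) (Fin N) ℂ)‖ = Real.sqrt (‖(w b : Matrix (Fin N) (Fin N) ℂ)‖ ^ 2) := (Real.sqrt_sq (norm_nonneg _)).symm
    _ ≤ Real.sqrt (p w ^ 2) := Real.sqrt_le_sqrt hb
    _ = p w := Real.sqrt_sq hp0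

/-! ## §2  The letter (δ₂) per height, in the junction's currency -/

/-- ★★★ **THE LETTER (δ₂) OF THE PACKAGE (N), PER HEIGHT, IN THE JUNCTION's CURRENCY**: for the `linAvg`-recursion family `Q` and any seminorm `p` with `Σ_b‖↑w_b‖²_op ≤ p(w)²` there are ONE `C ≥ 0`
and ONE `ρ > 0` (dag-n10-w1's module D) such that for every guarded background `U₀` (iterated averages `t₀`-small below `k`, `stokesConst·t₀ < δ_N`) with `‖↑U₀ − 1‖ < ρ`, every determining set `𝐁`,
every datum `W` with `M˙(U₀) = W` on `𝐁`, and every direction `w`: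
`‖D(msChart F N K k 𝐁 W U₀)(0) w − D(msChart F N K k 𝐁 (M˙1) 1)(0) w‖ ≤ C·‖↑U₀ − 1‖·p(w)` — J-C's `hδ₂` with `Lf := DΦ♭(0)` (the flat chart of record), `q := ‖·‖`, `δ₂ := C·‖↑U₀ − 1‖`.
Proof: componentwise, module D bounds `‖(DΨ(0)w)_i − π(Q^{(j)}w)(c)‖` at the self-datum, dag-n12-w3∕n10-w1's flat identity says `π(Q^{(j)}w)(c) = (DΦ♭(0)w)_i`, the datum is moved to `W` by the
fibre condition (`msChart_eq_msChart_avgFamily_of_agreeOn`), and `‖↑w‖ ≤ p(w)`. [cite: Balaban1989LargeFieldII, p.357, (1.12) p.359; Balaban1985Variational, Sect. C (44)–(48) p.285; Balaban1985Averaging, Prop. 3 (121)–(125) p.36; Balaban1988Convergent, (2.10)–(2.12) p.256] -/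
theorem exists_delta2_letter (k : ℕ)
    (Q : (i : ℕ) → (PBond (F.P K) 0 → Matrix (Fin N) (Fin N) ℂ) → PBond (F.P K) i → Matrix (Fin N) (Fin N) ℂ)
    (hQ0 : ∀ Y, Q 0 Y = Y) (hQs : ∀ (i : ℕ) (Y : PBond (F.P K) 0 → Matrix (Fin N) (Fin N) ℂ) (c : PBond (F.P K) (i + 1)), Q (i + 1) Y c = linAvg (Q i Y) c)
    (p : Seminorm ℝ (PBond (F.P K) 0 → lieSU (Fin N)))
    (hp : ∀ Y : PBond (F.P K) 0 → lieSU (Fin N), ∑ b, ‖(Y b : Matrix (Fin N) (Fin N) ℂ)‖ ^ 2 ≤ p Y ^ 2) :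
    ∃ C ρ : ℝ, 0 ≤ C ∧ 0 < ρ ∧ ∀ ⦃t₀ : ℝ⦄, 0 < t₀ → stokesConst (F.P K) * t₀ < deltaSU (Fin N) →
      ∀ (U₀ : GaugeField (F.P K) 0 (SU N)) (𝔹 : DetSet (F.P K)) (W : MSField (F.P K) (SU N)),
        (∀ i, i < k → PlaqSmall t₀ (Averaging.iter (avOfRecord F N K) i U₀)) → ‖coeField U₀ - 1‖ < ρ →
        AgreeOn 𝔹 (avgFamily (avOfRecord F N K) U₀) W →
        ∀ w : PBond (F.P K) 0 → lieSU (Fin N),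
          ‖fderiv ℝ (msChart F N K k 𝔹 W U₀) 0 w
              - fderiv ℝ (msChart F N K k 𝔹 (avgFamily (avOfRecord F N K) (1 : GaugeField (F.P K) 0 (SU N))) (1 : GaugeField (F.P K) 0 (SU N))) 0 w‖
            ≤ C * ‖coeField U₀ - 1‖ * p w := by
  obtain ⟨C, ρ, hC, hρ, hD⟩ := exists_norm_fderiv_msChart_sub_suProj_iterLin_le (F := F) (N := N) (K := K) (k := k) Q hQ0 hQs
  refine ⟨C, ρ, hC, hρ, fun t₀ ht₀ hstδ U₀ 𝔹 W hsm hU₀ hU w => ?_⟩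
  have hnn : 0 ≤ C * ‖coeField U₀ - 1‖ * p w := by
    have := apply_nonneg p w
    positivity
  rw [msChart_eq_msChart_avgFamily_of_agreeOn (k := k) hU]
  refine (pi_norm_le_iff_of_nonneg hnn).2 fun i => ?_
  rw [Pi.sub_apply, fderiv_msChart_one_apply_eq_iterLin Q hQ0 hQs 𝔹 w i]
  exact (hD ht₀ hstδ U₀ hsm hU₀ 𝔹 w i).trans (mul_le_mul_of_nonneg_left (opNormField_le_seminorm p hp w) (by positivity))

/-- ★★ **THE SAME AT THE RECORD's DETERMINING SET `𝐁_k(Z) = Bj M₁ Z k`** — the `hδ₂` binder of `B15Prop1EndpointNearFlatLetters.…_ofNearFlatLetters_sub_oneSided` with `Lf := DΦ♭(0)`, `q := ‖·‖`, at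
`w := X_f′X`, per height. [cite: Balaban1989LargeFieldII, p.357, (1.12) p.359; Balaban1988Convergent, (2.13) pp.256–257] -/
theorem exists_delta2_letter_Bj (k M₁ : ℕ) (Z : Set (Site (F.P K) 0))
    (Q : (i : ℕ) → (PBond (F.P K) 0 → Matrix (Fin N) (Fin N) ℂ) → PBond (F.P K) i → Matrix (Fin N) (Fin N) ℂ)
    (hQ0 : ∀ Y, Q 0 Y = Y) (hQs : ∀ (i : ℕ) (Y : PBond (F.P K) 0 → Matrix (Fin N) (Fin N) ℂ) (c : PBond (F.P K) (i + 1)), Q (i + 1) Y c = linAvg (Q i Y) c)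
    (p : Seminorm ℝ (PBond (F.P K) 0 → lieSU (Fin N)))
    (hp : ∀ Y : PBond (F.P K) 0 → lieSU (Fin N), ∑ b, ‖(Y b : Matrix (Fin N) (Fin N) ℂ)‖ ^ 2 ≤ p Y ^ 2) :
    ∃ C ρ : ℝ, 0 ≤ C ∧ 0 < ρ ∧ ∀ ⦃t₀ : ℝ⦄, 0 < t₀ → stokesConst (F.P K) * t₀ < deltaSU (Fin N) →
      ∀ (U₀ : GaugeField (F.P K) 0 (SU N)) (W : MSField (F.P K) (SU N)),
        (∀ i, i < k → PlaqSmall t₀ (Averaging.iter (avOfRecord F N K) i U₀)) → ‖coeField U₀ - 1‖ < ρ →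
        AgreeOn (Bj M₁ Z k) (avgFamily (avOfRecord F N K) U₀) W →
        ∀ w : PBond (F.P K) 0 → lieSU (Fin N),
          ‖fderiv ℝ (msChart F N K k (Bj M₁ Z k) W U₀) 0 w
              - fderiv ℝ (msChart F N K k (Bj M₁ Z k) (avgFamily (avOfRecord F N K) (1 : GaugeField (F.P K) 0 (SU N))) (1 : GaugeField (F.P K) 0 (SU N))) 0 w‖
            ≤ C * ‖coeField U₀ - 1‖ * p w := by
  obtain ⟨C, ρ, hC, hρ, h⟩ := exists_delta2_letter (F := F) (N := N) (K := K) k Q hQ0 hQs p hp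
  exact ⟨C, ρ, hC, hρ, fun t₀ ht₀ hstδ U₀ W hsm hU₀ hU w => h ht₀ hstδ U₀ (Bj M₁ Z k) W hsm hU₀ hU w⟩

/-! ## §3  From the FLAT right inverse and (δ₂) to the ACTUAL right inverse: the `R`-letter of `hlam`∕(μ) and `hsurj`, per height -/

section Actual

variable {E V : Type*} [AddCommGroup E] [Module ℝ E] [NormedAddCommGroup V] [NormedSpace ℝ V] [FiniteDimensional ℝ V]

/-- ★★ **FLAT RIGHT INVERSE + (δ₂) ⟹ ACTUAL RIGHT INVERSE, IN FUNCTION∕SEMINORM CURRENCY** (the Neumann-free edition of this seat's g2 `B16Ineq17NearFlatSubmersion.exists_rightInverse_fun_of_opNorm_sub_lt`,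
through dag-n10-w1's [folklore] `exists_rightInverse_of_approx`): a LINEAR flat right inverse `Hf` of `Lf` with `p(Hf v) ≤ ρ♭‖v‖`, the pointwise letter `‖L w − Lf w‖ ≤ δ₂·p(w)` and `δ₂ρ♭ < 1` give a
right inverse `R` of `L` AS A FUNCTION with `p(R v) ≤ ρ♭∕(1 − δ₂ρ♭)·‖v‖` — the binders `hR`∕`hρ` of `Node00.exists_lam_msChart_bound_of_rightInverse_fun` ∕ `exists_lam_mu_msChart_of_rightInverse_fun`.
[cite: Balaban1985Variational, (36)–(47) pp.283–285, (82)–(83) p.290; Balaban1989LargeFieldII, p.357] -/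
theorem exists_rightInverse_fun_of_flat_of_delta2 (p : Seminorm ℝ E) (L Lf : E →ₗ[ℝ] V) (Hf : V →ₗ[ℝ] E)
    (hHf : ∀ v, Lf (Hf v) = v) {ρf δ₂ : ℝ} (hρf0 : 0 ≤ ρf) (hδ₂0 : 0 ≤ δ₂) (hρf : ∀ v, p (Hf v) ≤ ρf * ‖v‖)
    (hδ₂ : ∀ w, ‖L w - Lf w‖ ≤ δ₂ * p w) (hsmall : δ₂ * ρf < 1) :
    ∃ R : V → E, (∀ v, L (R v) = v) ∧ ∀ v, p (R v) ≤ ρf / (1 - δ₂ * ρf) * ‖v‖ := by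
  have happrox : ∀ y, ‖L (Hf y) - y‖ ≤ δ₂ * ρf * ‖y‖ := fun y => by
    calc ‖L (Hf y) - y‖ = ‖L (Hf y) - Lf (Hf y)‖ := by rw [hHf]
      _ ≤ δ₂ * p (Hf y) := hδ₂ _
      _ ≤ δ₂ * (ρf * ‖y‖) := mul_le_mul_of_nonneg_left (hρf y) hδ₂0
      _ = δ₂ * ρf * ‖y‖ := by ring
  obtain ⟨G, hG, hGn⟩ := exists_rightInverse_of_approx L Hf hsmall happrox
  refine ⟨fun v => Hf (G v), fun v => hG v, fun v => ?_⟩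
  calc p (Hf (G v)) ≤ ρf * ‖G v‖ := hρf _
    _ ≤ ρf * ((1 - δ₂ * ρf)⁻¹ * ‖v‖) := mul_le_mul_of_nonneg_left (hGn v) hρf0
    _ = ρf / (1 - δ₂ * ρf) * ‖v‖ := by rw [div_eq_mul_inv]; ring

end Actual

/-- ★★★ **AT THE CHART OF RECORD: A FLAT LINEAR RIGHT INVERSE OF `DΦ♭(0)` WITH LETTER `p(Hf v) ≤ ρ♭‖v‖` GIVES, AT EVERY GUARDED BACKGROUND WITH `C·‖↑U₀ − 1‖·ρ♭ < 1` ON THE FIBRE, A RIGHT INVERSE OF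
`DΨ(0)` AS A FUNCTION WITH `p(R v) ≤ ρ♭∕(1 − C‖↑U₀ − 1‖ρ♭)·‖v‖`** — §2's (δ₂) + §3; hence `hsurj`, and the `hR`∕`hρ` binders of this seat's `hlam`∕(μ) producers (p610492 ∕ p613093), reduce at the
record to ONE displayed object: the flat linear right inverse `Hf` on `ConstrSet 𝐁 k` (dag-n10-w1's LOCATED way (ii) for `𝐁 = Bj M₁ Z k`). [cite: Balaban1985Variational, (36)–(47) pp.283–285, (82)–(83) p.290; Balaban1989LargeFieldII, p.357, (1.12) p.359] -/
theorem exists_rightInverse_fun_msChart_of_flat (k : ℕ)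
    (Q : (i : ℕ) → (PBond (F.P K) 0 → Matrix (Fin N) (Fin N) ℂ) → PBond (F.P K) i → Matrix (Fin N) (Fin N) ℂ)
    (hQ0 : ∀ Y, Q 0 Y = Y) (hQs : ∀ (i : ℕ) (Y : PBond (F.P K) 0 → Matrix (Fin N) (Fin N) ℂ) (c : PBond (F.P K) (i + 1)), Q (i + 1) Y c = linAvg (Q i Y) c)
    (p : Seminorm ℝ (PBond (F.P K) 0 → lieSU (Fin N)))
    (hp : ∀ Y : PBond (F.P K) 0 → lieSU (Fin N), ∑ b, ‖(Y b : Matrix (Fin N) (Fin N) ℂ)‖ ^ 2 ≤ p Y ^ 2) :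
    ∃ C ρ : ℝ, 0 ≤ C ∧ 0 < ρ ∧ ∀ ⦃t₀ : ℝ⦄, 0 < t₀ → stokesConst (F.P K) * t₀ < deltaSU (Fin N) →
      ∀ (U₀ : GaugeField (F.P K) 0 (SU N)) (𝔹 : DetSet (F.P K)) (W : MSField (F.P K) (SU N)),
        (∀ i, i < k → PlaqSmall t₀ (Averaging.iter (avOfRecord F N K) i U₀)) → ‖coeField U₀ - 1‖ < ρ →
        AgreeOn 𝔹 (avgFamily (avOfRecord F N K) U₀) W →
        ∀ (Hf : (Fin (constrCard 𝔹 k) → lieSU (Fin N)) →ₗ[ℝ] (PBond (F.P K) 0 → lieSU (Fin N))) {ρf : ℝ}, 0 ≤ ρf →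
          (∀ v, fderiv ℝ (msChart F N K k 𝔹 (avgFamily (avOfRecord F N K) (1 : GaugeField (F.P K) 0 (SU N))) (1 : GaugeField (F.P K) 0 (SU N))) 0 (Hf v) = v) →
          (∀ v, p (Hf v) ≤ ρf * ‖v‖) → C * ‖coeField U₀ - 1‖ * ρf < 1 →
          ∃ R : (Fin (constrCard 𝔹 k) → lieSU (Fin N)) → PBond (F.P K) 0 → lieSU (Fin N),
            (∀ v, fderiv ℝ (msChart F N K k 𝔹 W U₀) 0 (R v) = v) ∧ ∀ v, p (R v) ≤ ρf / (1 - C * ‖coeField U₀ - 1‖ * ρf) * ‖v‖ := by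
  obtain ⟨C, ρ, hC, hρ, h⟩ := exists_delta2_letter (F := F) (N := N) (K := K) k Q hQ0 hQs p hp
  refine ⟨C, ρ, hC, hρ, fun t₀ ht₀ hstδ U₀ 𝔹 W hsm hU₀ hU Hf ρf hρf0 hHf hρf hsmall => ?_⟩
  have hδ₂ := h ht₀ hstδ U₀ 𝔹 W hsm hU₀ hU
  exact exists_rightInverse_fun_of_flat_of_delta2 p
    ((fderiv ℝ (msChart F N K k 𝔹 W U₀) 0).toLinearMap)
    ((fderiv ℝ (msChart F N K k 𝔹 (avgFamily (avOfRecord F N K) (1 : GaugeField (F.P K) 0 (SU N))) (1 : GaugeField (F.P K) 0 (SU N))) 0).toLinearMap)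
    Hf hHf hρf0 (by positivity) hρf (fun w => hδ₂ w) hsmall

/-! ## §4  v1.1 (CLAIM-9): a GLOBALLY near-flat configuration is guarded at every level `≤ k` with an admissible threshold

The module-D guard `∀ i < k, PlaqSmall t₀ (Ū^i U₀)` (iterated averages with `t₀`-small plaquettes, `stokesConst·t₀ < δ_N`) DISCHARGED for globally near-flat configurations —
the shape the flattened PROXIES of `Node00.MultiScaleFibreChartLocality` have: level `0` by the four-factor estimate at the flat configuration (`plaqSmall_of_near`), levels `≥ 1` by
[Balaban1985Averaging] Prop. 2 iterated (`plaqSmall_iter_avOfRecord_level`, (53) at the averaging of record). -/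

section LocalEditions

variable {F : T4Family} {N : ℕ} [NeZero N] {K : ℕ}

open B14.Eq216Concrete (inputs)
open Summit.QuantumFields.YangMills.Theorems.BlockAvgCorrector (stokesConst_nonneg)

/-- ★ **NEAR-FLAT ⇒ GUARDED, WITH ONE ADMISSIBLE THRESHOLD PER HEIGHT**: there are `t₀ > 0` with `stokesConst·t₀ < δ_N` and `ρg > 0` such that every configuration with `‖↑U − 1‖ ≤ ρg`
has `t₀`-small plaquettes at every averaged level `i ≤ k`. [cite: Balaban1985Averaging, Prop. 2 (52)–(54) p.26; Balaban1987RG1, (0.4) p.253, (0.18) p.255] -/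
theorem exists_guard_of_nearFlat (K k : ℕ) :
    ∃ t₀ ρg : ℝ, 0 < t₀ ∧ stokesConst (F.P K) * t₀ < deltaSU (Fin N) ∧ 0 < ρg ∧
      ∀ U : GaugeField (F.P K) 0 (SU N), ‖coeField U - 1‖ ≤ ρg →
        ∀ i, i ≤ k → PlaqSmall t₀ (Averaging.iter (avOfRecord F N K) i U) := by
  obtain ⟨ts, hts, hst⟩ : ∃ ts : ℝ, 0 < ts ∧ stokesConst (F.P K) * ts < deltaSU (Fin N) := by
    refine ⟨deltaSU (Fin N) / (2 * (stokesConst (F.P K) + 1)),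
      by have := ExpMeanLog.deltaSU_pos (n := Fin N); have := stokesConst_nonneg (F.P K); positivity, ?_⟩
    have hδ := ExpMeanLog.deltaSU_pos (n := Fin N)
    have hs := stokesConst_nonneg (F.P K)
    rw [mul_div_assoc', div_lt_iff₀ (by positivity)]
    nlinarith
  have hLpos : (0 : ℝ) < ((F.P K).L : ℝ) := Nat.cast_pos.mpr (F.P K).L_pos
  have hC₁ : (0 : ℝ) < 143 * (((((F.P K).d + 4 : ℕ) : ℝ)) ^ 2 / 4) ^ 2 := by positivity
  have hC₂ : (0 : ℝ) < ((((F.P K).d + 4) * (F.P K).L : ℕ) : ℝ) ^ 2 := by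
    have h : (0 : ℝ) < ((((F.P K).d + 4) * (F.P K).L : ℕ) : ℝ) := by
      have := (F.P K).L_pos
      exact_mod_cast Nat.mul_pos (Nat.succ_pos _) this
    positivity
  have hδN := ExpMeanLog.deltaSU_pos (n := Fin N)
  set α₀ : ℝ := min (min (1 / (3 * (143 * (((((F.P K).d + 4 : ℕ) : ℝ)) ^ 2 / 4) ^ 2)))
    (deltaSU (Fin N) / ((((F.P K).d + 4) * (F.P K).L : ℕ) : ℝ) ^ 2)) (ts / 2) with hα₀
  have hα₀pos : 0 < α₀ := lt_min (lt_min (by positivity) (by positivity)) (by positivity)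
  have hα3 : (143 * (((((F.P K).d + 4 : ℕ) : ℝ)) ^ 2 / 4) ^ 2) * α₀ ≤ 1 / 3 := by
    have h : α₀ ≤ 1 / (3 * (143 * (((((F.P K).d + 4 : ℕ) : ℝ)) ^ 2 / 4) ^ 2)) := (min_le_left _ _).trans (min_le_left _ _)
    calc (143 * (((((F.P K).d + 4 : ℕ) : ℝ)) ^ 2 / 4) ^ 2) * α₀
        ≤ (143 * (((((F.P K).d + 4 : ℕ) : ℝ)) ^ 2 / 4) ^ 2) * (1 / (3 * (143 * (((((F.P K).d + 4 : ℕ) : ℝ)) ^ 2 / 4) ^ 2))) :=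
          mul_le_mul_of_nonneg_left h hC₁.le
      _ = 1 / 3 := by field_simp
  have hα2 : 2 * α₀ ≤ 2 * deltaSU (Fin N) / ((((F.P K).d + 4) * (F.P K).L : ℕ) : ℝ) ^ 2 := by
    have h : α₀ ≤ deltaSU (Fin N) / ((((F.P K).d + 4) * (F.P K).L : ℕ) : ℝ) ^ 2 := (min_le_left _ _).trans (min_le_right _ _)
    rw [mul_div_assoc]
    linarith
  have hαts : 2 * α₀ ≤ ts := by
    have h : α₀ ≤ ts / 2 := min_le_right _ _
    linarith
  have hη : 0 < (F.P K).eta k := by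
    rw [Params.eta]
    exact pow_pos (inv_pos.mpr hLpos) k
  refine ⟨2 * α₀, α₀ * (F.P K).eta k ^ 2 / 8, by positivity, ?_, by positivity, fun U hU i hi => ?_⟩
  · calc stokesConst (F.P K) * (2 * α₀) ≤ stokesConst (F.P K) * ts := mul_le_mul_of_nonneg_left hαts (stokesConst_nonneg _)
      _ < deltaSU (Fin N) := hst
  · have hnear : ∀ b : PBond (F.P K) 0,
        ‖((U b : SU N) : Matrix (Fin N) (Fin N) ℂ) - (((1 : GaugeField (F.P K) 0 (SU N)) b : SU N) : Matrix (Fin N) (Fin N) ℂ)‖ ≤ α₀ * (F.P K).eta k ^ 2 / 8 := by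
      intro b
      have h := (norm_le_pi_norm (coeField U - 1) b).trans hU
      have h1b : (((1 : GaugeField (F.P K) 0 (SU N)) b : SU N) : Matrix (Fin N) (Fin N) ℂ) = 1 := rfl
      rw [h1b]
      simpa [coeField] using h
    have h1 : PlaqSmall (α₀ * (F.P K).eta k ^ 2 / 2) (1 : GaugeField (F.P K) 0 (SU N)) := T3DescentFibreTower.plaqSmall_one (by positivity)
    have h52' := Summit.QuantumFields.YangMills.Theorems.SmoothLiftPerturbation.plaqSmall_of_near hnear h1
    have h52 : PlaqSmall (α₀ * (F.P K).eta k ^ 2) U := fun q => (h52' q).trans_le (le_of_eq (by ring))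
    have hlev := Summit.QuantumFields.YangMills.Theorems.N21AveragedDatumRegularity.plaqSmall_iter_avOfRecord_level (N := N) K k hα₀pos hα3 hα2 h52 hi
    have hL1 : (1 : ℝ) ≤ ((F.P K).L : ℝ) := by exact_mod_cast (F.P K).L_pos
    have hLk : (0 : ℝ) < ((F.P K).L : ℝ) ^ k := by positivity
    have hx1 : ((F.P K).L : ℝ) ^ i * (F.P K).eta k ≤ 1 := by
      rw [Params.eta, inv_pow, mul_inv_le_iff₀ hLk, one_mul]
      exact pow_le_pow_right₀ hL1 hi
    have hx0 : 0 ≤ ((F.P K).L : ℝ) ^ i * (F.P K).eta k := (mul_pos (by positivity) hη).le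
    intro q
    refine (hlev q).trans_le ?_
    have hsq : (((F.P K).L : ℝ) ^ i * (F.P K).eta k) ^ 2 ≤ 1 := pow_le_one₀ hx0 hx1
    calc 2 * α₀ * (((F.P K).L : ℝ) ^ i * (F.P K).eta k) ^ 2 ≤ 2 * α₀ * 1 := mul_le_mul_of_nonneg_left hsq (by positivity)
      _ = 2 * α₀ := mul_one _

/-! ## §5  v1.1: the letter (δ₂), LOCAL EDITION — near-flatness asked only on `inputs 𝐁` -/

/-- ★★★ **THE LETTER (δ₂), LOCAL EDITION**: ONE `C ≥ 0` and ONE `ρ > 0` per height such that for every determining set `𝐁` with no member above `k ≤ m + K`, every datum `W` and every `U₀`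
IN THE FIBRE that is `δ`-near-flat ON `inputs 𝐁` ONLY (`0 ≤ δ < ρ`): `‖DΨ_{𝐁,W,U₀}(0)w − DΨ_{𝐁,M˙1,1}(0)w‖ ≤ C·δ·p(w)` — §2's global letter applied to the flattened proxy `U′` of
`Node00.exists_nearFlat_eqOn` (globally `δ`-near-flat, hence guarded by §4 and in the fibre by locality) and transported back by `Node00.msChart_congr_of_eqOn_inputs`
(`Ψ_{𝐁,W,U₀} = Ψ_{𝐁,W,U′}`).  No global hypothesis on `U₀` remains. [cite: Balaban1989LargeFieldII, (1.12)–(1.13) p.359, (1.77) p.373; Balaban1985Variational, (47) p.285, (81) p.290; Balaban1985Averaging, Prop. 3 (121)–(125) p.36; Balaban1988Convergent, (2.11)–(2.13) pp.256–257] -/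
theorem exists_delta2_letter_local (k : ℕ)
    (Q : (i : ℕ) → (PBond (F.P K) 0 → Matrix (Fin N) (Fin N) ℂ) → PBond (F.P K) i → Matrix (Fin N) (Fin N) ℂ)
    (hQ0 : ∀ Y, Q 0 Y = Y) (hQs : ∀ (i : ℕ) (Y : PBond (F.P K) 0 → Matrix (Fin N) (Fin N) ℂ) (c : PBond (F.P K) (i + 1)), Q (i + 1) Y c = linAvg (Q i Y) c)
    (p : Seminorm ℝ (PBond (F.P K) 0 → lieSU (Fin N)))
    (hp : ∀ Y : PBond (F.P K) 0 → lieSU (Fin N), ∑ b, ‖(Y b : Matrix (Fin N) (Fin N) ℂ)‖ ^ 2 ≤ p Y ^ 2) :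
    ∃ C ρ : ℝ, 0 ≤ C ∧ 0 < ρ ∧
      ∀ (𝔹 : DetSet (F.P K)) (W : MSField (F.P K) (SU N)) (U₀ : GaugeField (F.P K) 0 (SU N)),
        (∀ j, k < j → 𝔹 j = ∅) → k ≤ (F.P K).m + (F.P K).K →
        ∀ ⦃δ : ℝ⦄, 0 ≤ δ → δ < ρ → (∀ b ∈ inputs 𝔹, ‖((U₀ b : SU N) : Matrix (Fin N) (Fin N) ℂ) - 1‖ ≤ δ) →
        AgreeOn 𝔹 (avgFamily (avOfRecord F N K) U₀) W →
        ∀ w : PBond (F.P K) 0 → lieSU (Fin N),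
          ‖fderiv ℝ (msChart F N K k 𝔹 W U₀) 0 w
              - fderiv ℝ (msChart F N K k 𝔹 (avgFamily (avOfRecord F N K) (1 : GaugeField (F.P K) 0 (SU N))) (1 : GaugeField (F.P K) 0 (SU N))) 0 w‖
            ≤ C * δ * p w := by
  obtain ⟨C, ρ₁, hC, hρ₁, h⟩ := exists_delta2_letter (F := F) (N := N) (K := K) k Q hQ0 hQs p hp
  obtain ⟨t₀, ρg, ht₀, hst, hρg, hguard⟩ := exists_guard_of_nearFlat (F := F) (N := N) K k
  refine ⟨C, min ρ₁ ρg, hC, lt_min hρ₁ hρg, fun 𝔹 W U₀ h𝔹 hk δ hδ0 hδρ hloc hU w => ?_⟩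
  obtain ⟨U', hin, hflat⟩ := Node00.exists_nearFlat_eqOn U₀ (inputs 𝔹) hδ0 hloc
  have hU' : AgreeOn 𝔹 (avgFamily (avOfRecord F N K) U') W :=
    (Node00.agreeOn_iff_of_eqOn_inputs (W := W) h𝔹 hk fun b hb => (hin b hb).symm).1 hU
  have hg : ∀ i, i < k → PlaqSmall t₀ (Averaging.iter (avOfRecord F N K) i U') :=
    fun i hi => hguard U' (hflat.trans (hδρ.le.trans (min_le_right _ _))) i hi.le
  have hlt : ‖coeField U' - 1‖ < ρ₁ := lt_of_le_of_lt hflat (lt_of_lt_of_le hδρ (min_le_left _ _))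
  have key := h ht₀ hst U' 𝔹 W hg hlt hU' w
  rw [Node00.msChart_congr_of_eqOn_inputs (W := W) hk fun b hb => (hin b hb).symm]
  exact key.trans (mul_le_mul_of_nonneg_right (mul_le_mul_of_nonneg_left hflat hC) (apply_nonneg p w))

/-- ★★ **THE SAME AT THE RECORD's DETERMINING SET `𝐁_k(Z) = Bj M₁ Z k`** (no member above `k`): the J-C binder `hδ₂` with near-flatness of `U₀` asked only on `inputs (Bj M₁ Z k)`.
[cite: Balaban1989LargeFieldII, p.357, (1.12) p.359; Balaban1988Convergent, (2.13) pp.256–257] -/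
theorem exists_delta2_letter_local_Bj (k M₁ : ℕ) (Z : Set (Site (F.P K) 0))
    (Q : (i : ℕ) → (PBond (F.P K) 0 → Matrix (Fin N) (Fin N) ℂ) → PBond (F.P K) i → Matrix (Fin N) (Fin N) ℂ)
    (hQ0 : ∀ Y, Q 0 Y = Y) (hQs : ∀ (i : ℕ) (Y : PBond (F.P K) 0 → Matrix (Fin N) (Fin N) ℂ) (c : PBond (F.P K) (i + 1)), Q (i + 1) Y c = linAvg (Q i Y) c)
    (p : Seminorm ℝ (PBond (F.P K) 0 → lieSU (Fin N)))
    (hp : ∀ Y : PBond (F.P K) 0 → lieSU (Fin N), ∑ b, ‖(Y b : Matrix (Fin N) (Fin N) ℂ)‖ ^ 2 ≤ p Y ^ 2) :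
    ∃ C ρ : ℝ, 0 ≤ C ∧ 0 < ρ ∧
      ∀ (W : MSField (F.P K) (SU N)) (U₀ : GaugeField (F.P K) 0 (SU N)), k ≤ (F.P K).m + (F.P K).K →
        ∀ ⦃δ : ℝ⦄, 0 ≤ δ → δ < ρ → (∀ b ∈ inputs (Bj M₁ Z k), ‖((U₀ b : SU N) : Matrix (Fin N) (Fin N) ℂ) - 1‖ ≤ δ) →
        AgreeOn (Bj M₁ Z k) (avgFamily (avOfRecord F N K) U₀) W →
        ∀ w : PBond (F.P K) 0 → lieSU (Fin N),
          ‖fderiv ℝ (msChart F N K k (Bj M₁ Z k) W U₀) 0 w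
              - fderiv ℝ (msChart F N K k (Bj M₁ Z k) (avgFamily (avOfRecord F N K) (1 : GaugeField (F.P K) 0 (SU N))) (1 : GaugeField (F.P K) 0 (SU N))) 0 w‖
            ≤ C * δ * p w := by
  obtain ⟨C, ρ, hC, hρ, h⟩ := exists_delta2_letter_local (F := F) (N := N) (K := K) k Q hQ0 hQs p hp
  exact ⟨C, ρ, hC, hρ, fun W U₀ hk δ hδ0 hδρ hloc hU w => h (Bj M₁ Z k) W U₀ (fun _ hj => B14.Eq213DetSet.Bj_of_gt hj) hk hδ0 hδρ hloc hU w⟩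

/-! ## §6  v1.1: flat ⇒ near-flat right inverse, LOCAL EDITION -/

/-- ★★ **FLAT ⇒ NEAR-FLAT RIGHT INVERSE, LOCAL EDITION**: for `U₀` in the fibre, `δ`-near-flat ON `inputs 𝐁` only (`0 ≤ δ < ρ`), a FLAT linear right inverse `Hf` of `DΦ♭(0)` with
`p(Hf v) ≤ ρf‖v‖` and `C·δ·ρf < 1` yields a right-inverse FUNCTION `R` of `DΨ_{𝐁,W,U₀}(0)` with `p(Rv) ≤ ρf∕(1 − Cδρf)·‖v‖` — the J-C binders `Rf`, `hRf`, `hρ` at the record's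
`U₀` from dag-n10-w1's flat onto-ness, with no global hypothesis on `U₀`. [cite: Balaban1989LargeFieldII, (1.13) p.359; Balaban1985Variational, (45) p.285, (47)–(48) p.285; Balaban1988Convergent, (2.11)–(2.13) pp.256–257] -/
theorem exists_rightInverse_fun_msChart_of_flat_local (k : ℕ)
    (Q : (i : ℕ) → (PBond (F.P K) 0 → Matrix (Fin N) (Fin N) ℂ) → PBond (F.P K) i → Matrix (Fin N) (Fin N) ℂ)
    (hQ0 : ∀ Y, Q 0 Y = Y) (hQs : ∀ (i : ℕ) (Y : PBond (F.P K) 0 → Matrix (Fin N) (Fin N) ℂ) (c : PBond (F.P K) (i + 1)), Q (i + 1) Y c = linAvg (Q i Y) c)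
    (p : Seminorm ℝ (PBond (F.P K) 0 → lieSU (Fin N)))
    (hp : ∀ Y : PBond (F.P K) 0 → lieSU (Fin N), ∑ b, ‖(Y b : Matrix (Fin N) (Fin N) ℂ)‖ ^ 2 ≤ p Y ^ 2) :
    ∃ C ρ : ℝ, 0 ≤ C ∧ 0 < ρ ∧
      ∀ (𝔹 : DetSet (F.P K)) (W : MSField (F.P K) (SU N)) (U₀ : GaugeField (F.P K) 0 (SU N)),
        (∀ j, k < j → 𝔹 j = ∅) → k ≤ (F.P K).m + (F.P K).K →
        ∀ ⦃δ : ℝ⦄, 0 ≤ δ → δ < ρ → (∀ b ∈ inputs 𝔹, ‖((U₀ b : SU N) : Matrix (Fin N) (Fin N) ℂ) - 1‖ ≤ δ) →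
        AgreeOn 𝔹 (avgFamily (avOfRecord F N K) U₀) W →
        ∀ (Hf : (Fin (constrCard 𝔹 k) → lieSU (Fin N)) →ₗ[ℝ] (PBond (F.P K) 0 → lieSU (Fin N))) {ρf : ℝ}, 0 ≤ ρf →
          (∀ v, fderiv ℝ (msChart F N K k 𝔹 (avgFamily (avOfRecord F N K) (1 : GaugeField (F.P K) 0 (SU N))) (1 : GaugeField (F.P K) 0 (SU N))) 0 (Hf v) = v) →
          (∀ v, p (Hf v) ≤ ρf * ‖v‖) → C * δ * ρf < 1 →
          ∃ R : (Fin (constrCard 𝔹 k) → lieSU (Fin N)) → PBond (F.P K) 0 → lieSU (Fin N),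
            (∀ v, fderiv ℝ (msChart F N K k 𝔹 W U₀) 0 (R v) = v) ∧ ∀ v, p (R v) ≤ ρf / (1 - C * δ * ρf) * ‖v‖ := by
  obtain ⟨C, ρ, hC, hρ, h⟩ := exists_delta2_letter_local (F := F) (N := N) (K := K) k Q hQ0 hQs p hp
  refine ⟨C, ρ, hC, hρ, fun 𝔹 W U₀ h𝔹 hk δ hδ0 hδρ hloc hU Hf ρf hρf0 hHf hρf hsmall => ?_⟩
  have hδ₂ := h 𝔹 W U₀ h𝔹 hk hδ0 hδρ hloc hU
  exact exists_rightInverse_fun_of_flat_of_delta2 p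
    ((fderiv ℝ (msChart F N K k 𝔹 W U₀) 0).toLinearMap)
    ((fderiv ℝ (msChart F N K k 𝔹 (avgFamily (avOfRecord F N K) (1 : GaugeField (F.P K) 0 (SU N))) (1 : GaugeField (F.P K) 0 (SU N))) 0).toLinearMap)
    Hf hHf hρf0 (by positivity) hρf (fun w => hδ₂ w) hsmall

/-! ## §7  v1.1: the same right inverses WITH THEIR RANGE IN `range Hf` (support control for the knit: `R v = Hf w`) -/

section Range

variable {E V : Type*} [AddCommGroup E] [Module ℝ E] [NormedAddCommGroup V] [NormedSpace ℝ V] [FiniteDimensional ℝ V]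

/-- §3's right inverse with its RANGE RECORDED: `R = Hf ∘ G`, so every `R v` is some `Hf w` (whatever support ∕ gauge property the flat right inverse has passes to `R`).
[cite: Balaban1985Variational, (36)–(47) pp.283–285; Balaban1989LargeFieldII, p.357] -/
theorem exists_rightInverse_fun_of_flat_of_delta2_range (p : Seminorm ℝ E) (L Lf : E →ₗ[ℝ] V) (Hf : V →ₗ[ℝ] E)
    (hHf : ∀ v, Lf (Hf v) = v) {ρf δ₂ : ℝ} (hρf0 : 0 ≤ ρf) (hδ₂0 : 0 ≤ δ₂) (hρf : ∀ v, p (Hf v) ≤ ρf * ‖v‖)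
    (hδ₂ : ∀ w, ‖L w - Lf w‖ ≤ δ₂ * p w) (hsmall : δ₂ * ρf < 1) :
    ∃ R : V → E, (∀ v, L (R v) = v) ∧ (∀ v, p (R v) ≤ ρf / (1 - δ₂ * ρf) * ‖v‖) ∧ ∀ v, ∃ w, R v = Hf w := by
  have happrox : ∀ y, ‖L (Hf y) - y‖ ≤ δ₂ * ρf * ‖y‖ := fun y => by
    calc ‖L (Hf y) - y‖ = ‖L (Hf y) - Lf (Hf y)‖ := by rw [hHf]
      _ ≤ δ₂ * p (Hf y) := hδ₂ _
      _ ≤ δ₂ * (ρf * ‖y‖) := mul_le_mul_of_nonneg_left (hρf y) hδ₂0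
      _ = δ₂ * ρf * ‖y‖ := by ring
  obtain ⟨G, hG, hGn⟩ := exists_rightInverse_of_approx L Hf hsmall happrox
  refine ⟨fun v => Hf (G v), fun v => hG v, fun v => ?_, fun v => ⟨G v, rfl⟩⟩
  calc p (Hf (G v)) ≤ ρf * ‖G v‖ := hρf _
    _ ≤ ρf * ((1 - δ₂ * ρf)⁻¹ * ‖v‖) := mul_le_mul_of_nonneg_left (hGn v) hρf0
    _ = ρf / (1 - δ₂ * ρf) * ‖v‖ := by rw [div_eq_mul_inv]; ring

end Range

/-- ★★ **FLAT ⇒ NEAR-FLAT RIGHT INVERSE, LOCAL EDITION, WITH RANGE IN `range Hf`**: as `exists_rightInverse_fun_msChart_of_flat_local`, recording `∀ v, ∃ w, R v = Hf w` — so a flat right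
inverse supported under the constrained blocks yields an `R` supported there (the support the localised first-variation letter `hj` and the slice letters need).
[cite: Balaban1989LargeFieldII, (1.13) p.359; Balaban1985Variational, (45) p.285, (47)–(48) p.285; Balaban1988Convergent, (2.11)–(2.13) pp.256–257] -/
theorem exists_rightInverse_fun_msChart_of_flat_local_range (k : ℕ)
    (Q : (i : ℕ) → (PBond (F.P K) 0 → Matrix (Fin N) (Fin N) ℂ) → PBond (F.P K) i → Matrix (Fin N) (Fin N) ℂ)
    (hQ0 : ∀ Y, Q 0 Y = Y) (hQs : ∀ (i : ℕ) (Y : PBond (F.P K) 0 → Matrix (Fin N) (Fin N) ℂ) (c : PBond (F.P K) (i + 1)), Q (i + 1) Y c = linAvg (Q i Y) c)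
    (p : Seminorm ℝ (PBond (F.P K) 0 → lieSU (Fin N)))
    (hp : ∀ Y : PBond (F.P K) 0 → lieSU (Fin N), ∑ b, ‖(Y b : Matrix (Fin N) (Fin N) ℂ)‖ ^ 2 ≤ p Y ^ 2) :
    ∃ C ρ : ℝ, 0 ≤ C ∧ 0 < ρ ∧
      ∀ (𝔹 : DetSet (F.P K)) (W : MSField (F.P K) (SU N)) (U₀ : GaugeField (F.P K) 0 (SU N)),
        (∀ j, k < j → 𝔹 j = ∅) → k ≤ (F.P K).m + (F.P K).K →
        ∀ ⦃δ : ℝ⦄, 0 ≤ δ → δ < ρ → (∀ b ∈ inputs 𝔹, ‖((U₀ b : SU N) : Matrix (Fin N) (Fin N) ℂ) - 1‖ ≤ δ) →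
        AgreeOn 𝔹 (avgFamily (avOfRecord F N K) U₀) W →
        ∀ (Hf : (Fin (constrCard 𝔹 k) → lieSU (Fin N)) →ₗ[ℝ] (PBond (F.P K) 0 → lieSU (Fin N))) {ρf : ℝ}, 0 ≤ ρf →
          (∀ v, fderiv ℝ (msChart F N K k 𝔹 (avgFamily (avOfRecord F N K) (1 : GaugeField (F.P K) 0 (SU N))) (1 : GaugeField (F.P K) 0 (SU N))) 0 (Hf v) = v) →
          (∀ v, p (Hf v) ≤ ρf * ‖v‖) → C * δ * ρf < 1 →
          ∃ R : (Fin (constrCard 𝔹 k) → lieSU (Fin N)) → PBond (F.P K) 0 → lieSU (Fin N),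
            (∀ v, fderiv ℝ (msChart F N K k 𝔹 W U₀) 0 (R v) = v) ∧ (∀ v, p (R v) ≤ ρf / (1 - C * δ * ρf) * ‖v‖) ∧ ∀ v, ∃ w, R v = Hf w := by
  obtain ⟨C, ρ, hC, hρ, h⟩ := exists_delta2_letter_local (F := F) (N := N) (K := K) k Q hQ0 hQs p hp
  refine ⟨C, ρ, hC, hρ, fun 𝔹 W U₀ h𝔹 hk δ hδ0 hδρ hloc hU Hf ρf hρf0 hHf hρf hsmall => ?_⟩
  have hδ₂ := h 𝔹 W U₀ h𝔹 hk hδ0 hδρ hloc hU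
  exact exists_rightInverse_fun_of_flat_of_delta2_range p
    ((fderiv ℝ (msChart F N K k 𝔹 W U₀) 0).toLinearMap)
    ((fderiv ℝ (msChart F N K k 𝔹 (avgFamily (avOfRecord F N K) (1 : GaugeField (F.P K) 0 (SU N))) (1 : GaugeField (F.P K) 0 (SU N))) 0).toLinearMap)
    Hf hHf hρf0 (by positivity) hρf (fun w => hδ₂ w) hsmall

end LocalEditions

end Summit.QuantumFields.YangMills.BalabanUVNodes.N12NearFlatDelta2Letter

end
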